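import Literature.NumberTheory.LFunctions.TypeLimitsExist

/-!
# The logarithmic Riesz cut-off weights `(1 − log(κ_M r n)/log M)₊` are regular

The finite weighted type inequalities of the 2001 magnification programme (archive `2001`, [CV] App. A / W-MAG §3;
in the tree: the comb evaluation (TI_M) of the crux line
`Summits/RiemannHypothesis/RiemannHypothesis/Cruxes/ConeMagnification`, `COMB-EVALUATION.md` §4) carry, on each
gcd class, the cut-off weight `w_M(n) = (1 − log(κ_M·r·n)/log M)₊` with `κ_M = (log M)^θ` and a class constant
`r = ℓℓ'/δ² > 0`.  The arithmetic interfaces of `TypeLimitsExist.lean`, `FiniteTypeInequalities.lean`,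
`ClassSumsConverge.lean` ask of a weight family exactly: eventually nonincreasing in `n`, values in `[0,1]`,
vanishing from `N_M = M` on, `→ 1` pointwise, and (for the comparison form of [CV] Lemma 3.4) monotone in the class
constant `r`.  This file PROVES all of these for the explicit expression
`max (1 - Real.log (κ M * r * n) / Real.log M) 0` (no new definition), and that `κ_M = (log M)^θ` (`θ > 0`)
qualifies: `1 ≤ κ_M r` eventually and `log(κ_M r)/log M → 0` (`logPow_mul_eventually_one_le`,
`tendsto_log_logPow_mul_div_log`).  [folklore] throughout.
-/

noncomputable section

open Filter Finset
open _root_.Topology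

namespace Literature.NumberTheory.LFunctions

namespace TypeDesign

/-! ### Pointwise properties (fixed `M`) -/

/-- The log-Riesz weight is nonnegative. [folklore] -/
theorem logRiesz_nonneg (κ r : ℝ) (M n : ℕ) : 0 ≤ max (1 - Real.log (κ * r * n) / Real.log M) 0 :=
  le_max_right _ _

/-- The log-Riesz weight is `≤ 1` once `κ r ≥ 1`. [folklore] -/
theorem logRiesz_le_one {κ r : ℝ} (hκr : 1 ≤ κ * r) (M n : ℕ) :
    max (1 - Real.log (κ * r * n) / Real.log M) 0 ≤ 1 := by
  refine max_le ?_ zero_le_one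
  have h : 0 ≤ Real.log (κ * r * n) := by
    rcases Nat.eq_zero_or_pos n with rfl | hn
    · simp
    · exact Real.log_nonneg (by
        have : (1 : ℝ) ≤ n := by exact_mod_cast hn
        nlinarith)
  linarith [div_nonneg h (Real.log_natCast_nonneg M)]

/-- The log-Riesz weight is nonincreasing in `n` once `κ r ≥ 1`. [folklore] -/
theorem logRiesz_antitone {κ r : ℝ} (hκr : 1 ≤ κ * r) (M : ℕ) :
    Antitone (fun n : ℕ => max (1 - Real.log (κ * r * n) / Real.log M) 0) := by
  have hκ0 : 0 < κ * r := by linarith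
  refine antitone_nat_of_succ_le fun n => max_le_max ?_ le_rfl
  rcases Nat.eq_zero_or_pos n with rfl | hn
  · simp only [Nat.cast_zero, mul_zero, Real.log_zero, zero_div, sub_zero, zero_add, Nat.cast_one, mul_one]
    exact sub_le_self _ (div_nonneg (Real.log_nonneg hκr) (Real.log_natCast_nonneg M))
  · have hlog : Real.log (κ * r * n) ≤ Real.log (κ * r * ((n + 1 : ℕ) : ℝ)) :=
      Real.log_le_log (by positivity) (by push_cast; nlinarith)
    have := div_le_div_of_nonneg_right hlog (Real.log_natCast_nonneg M)
    linarith

/-- The log-Riesz weight vanishes for `n ≥ M` once `κ r ≥ 1` and `M ≥ 2`. [folklore] -/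
theorem logRiesz_eq_zero {κ r : ℝ} (hκr : 1 ≤ κ * r) {M n : ℕ} (hM : 2 ≤ M) (hn : M ≤ n) :
    max (1 - Real.log (κ * r * n) / Real.log M) 0 = 0 := by
  have hM0 : 0 < Real.log M := Real.log_pos (by exact_mod_cast hM)
  have hle : Real.log M ≤ Real.log (κ * r * n) :=
    Real.log_le_log (by positivity) (by
      calc (M : ℝ) ≤ n := by exact_mod_cast hn
        _ = 1 * n := (one_mul _).symm
        _ ≤ κ * r * n := by gcongr)
  refine max_eq_right ?_
  rw [sub_nonpos, le_div_iff₀ hM0, one_mul]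
  exact hle

/-- The log-Riesz weight is nonincreasing in the class constant: `r ≤ r'` gives `w_{r'} ≤ w_r` (`κ > 0`, `r > 0`).
This is the comparison `w² ≤ w⁴` used for [CV] Lemma 3.4 with class-dependent cut-offs. [folklore] -/
theorem logRiesz_anti_right {κ r r' : ℝ} (hκ : 0 < κ) (hr : 0 < r) (hrr' : r ≤ r') (M n : ℕ) :
    max (1 - Real.log (κ * r' * n) / Real.log M) 0 ≤ max (1 - Real.log (κ * r * n) / Real.log M) 0 := by
  refine max_le_max ?_ le_rfl
  rcases Nat.eq_zero_or_pos n with rfl | hn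
  · simp
  · have hn' : (0 : ℝ) < n := by exact_mod_cast hn
    have hlog : Real.log (κ * r * n) ≤ Real.log (κ * r' * n) :=
      Real.log_le_log (by positivity) (by gcongr)
    have := div_le_div_of_nonneg_right hlog (Real.log_natCast_nonneg M)
    linarith

/-! ### Along `M → ∞` -/

/-- Pointwise convergence to `1`: if `κ_M r ≥ 1` eventually and `log(κ_M r)/log M → 0`, then for every `n`,
`(1 − log(κ_M r n)/log M)₊ → 1`. [folklore] -/
theorem tendsto_logRiesz {κ : ℕ → ℝ} {r : ℝ} (hκ1 : ∀ᶠ M in atTop, 1 ≤ κ M * r)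
    (hκ : Tendsto (fun M : ℕ => Real.log (κ M * r) / Real.log M) atTop (𝓝 0)) (n : ℕ) :
    Tendsto (fun M : ℕ => max (1 - Real.log (κ M * r * n) / Real.log M) 0) atTop (𝓝 1) := by
  rcases Nat.eq_zero_or_pos n with rfl | hn
  · simp
  · have h1 : Tendsto (fun M : ℕ => Real.log (κ M * r * n) / Real.log M) atTop (𝓝 0) := by
      have hA : Tendsto (fun M : ℕ => Real.log n / Real.log (M : ℝ)) atTop (𝓝 0) :=
        tendsto_const_nhds.div_atTop (Real.tendsto_log_atTop.comp tendsto_natCast_atTop_atTop)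
      have h := hκ.add hA
      rw [add_zero] at h
      refine h.congr' ?_
      filter_upwards [hκ1] with M hM
      rw [Real.log_mul (x := κ M * r) (y := (n : ℝ)) (by linarith : (0 : ℝ) < κ M * r).ne'
        (by exact_mod_cast hn.ne'), add_div]
    have h2 := ((tendsto_const_nhds (x := (1 : ℝ))).sub h1).max (tendsto_const_nhds (x := (0 : ℝ)))
    rw [sub_zero, max_eq_left zero_le_one] at h2
    exact h2

/-- The regularity package of the log-Riesz weights along `M → ∞` (index `M : ℕ`, support bound `N M = M`), in the
shape of the hypotheses `hw_anti`, `hw_nonneg`, `hw_le`, `hw_zero`, `hw_one` of `tendsto_sum_mul_weight_of_tendsto`,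
`summable_local_of_twoPoint_bound`, `summable_local_of_weighted_bound`, `typeLimit_le_of_eventually_le(_sum)`,
`designData_of_mertens_finiteTypeIneq`. [folklore] -/
theorem logRiesz_regular {κ : ℕ → ℝ} {r : ℝ} (hκ1 : ∀ᶠ M in atTop, 1 ≤ κ M * r)
    (hκ : Tendsto (fun M : ℕ => Real.log (κ M * r) / Real.log M) atTop (𝓝 0)) :
    (∀ᶠ M : ℕ in atTop, Antitone (fun n : ℕ => max (1 - Real.log (κ M * r * n) / Real.log M) 0)) ∧
    (∀ᶠ M : ℕ in atTop, ∀ n : ℕ, 0 ≤ max (1 - Real.log (κ M * r * n) / Real.log M) 0) ∧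
    (∀ᶠ M : ℕ in atTop, ∀ n : ℕ, max (1 - Real.log (κ M * r * n) / Real.log M) 0 ≤ 1) ∧
    (∀ᶠ M : ℕ in atTop, ∀ n : ℕ, M ≤ n → max (1 - Real.log (κ M * r * n) / Real.log M) 0 = 0) ∧
    (∀ n : ℕ, Tendsto (fun M : ℕ => max (1 - Real.log (κ M * r * n) / Real.log M) 0) atTop (𝓝 1)) := by
  refine ⟨?_, Eventually.of_forall fun M n => logRiesz_nonneg _ _ _ _, ?_, ?_, tendsto_logRiesz hκ1 hκ⟩
  · filter_upwards [hκ1] with M hM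
    exact logRiesz_antitone hM M
  · filter_upwards [hκ1] with M hM n
    exact logRiesz_le_one hM M n
  · filter_upwards [hκ1, eventually_ge_atTop 2] with M hM hM2 n hn
    exact logRiesz_eq_zero hM hM2 hn

/-! ### `κ_M = (log M)^θ` qualifies -/

/-- `log log M / log M → 0` along `M : ℕ`. [folklore] -/
theorem tendsto_log_log_div_log :
    Tendsto (fun M : ℕ => Real.log (Real.log M) / Real.log M) atTop (𝓝 0) :=
  Real.isLittleO_log_id_atTop.tendsto_div_nhds_zero.comp
    (Real.tendsto_log_atTop.comp tendsto_natCast_atTop_atTop)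

/-- For `θ > 0` and `r > 0`: `1 ≤ (log M)^θ · r` eventually. [folklore] -/
theorem logPow_mul_eventually_one_le {θ : ℝ} (hθ : 0 < θ) {r : ℝ} (hr : 0 < r) :
    ∀ᶠ M : ℕ in atTop, 1 ≤ Real.log M ^ θ * r := by
  have h : Tendsto (fun M : ℕ => Real.log M ^ θ * r) atTop atTop :=
    ((tendsto_rpow_atTop hθ).comp (Real.tendsto_log_atTop.comp tendsto_natCast_atTop_atTop)).atTop_mul_const hr
  exact h.eventually_ge_atTop 1

/-- For real `θ` and `r > 0`: `log((log M)^θ · r)/log M → 0`. [folklore] -/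
theorem tendsto_log_logPow_mul_div_log (θ : ℝ) {r : ℝ} (hr : 0 < r) :
    Tendsto (fun M : ℕ => Real.log (Real.log M ^ θ * r) / Real.log M) atTop (𝓝 0) := by
  have h1 : Tendsto (fun M : ℕ => θ * (Real.log (Real.log M) / Real.log M) + Real.log r / Real.log M)
      atTop (𝓝 (θ * 0 + 0)) :=
    (tendsto_log_log_div_log.const_mul θ).add
      (tendsto_const_nhds.div_atTop (Real.tendsto_log_atTop.comp tendsto_natCast_atTop_atTop))
  rw [mul_zero, add_zero] at h1
  refine h1.congr' ?_
  have hlog : ∀ᶠ M : ℕ in atTop, 0 < Real.log M := by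
    filter_upwards [eventually_ge_atTop 2] with M hM
    exact Real.log_pos (by exact_mod_cast hM)
  filter_upwards [hlog] with M hM
  rw [Real.log_mul (by positivity) hr.ne', Real.log_rpow hM, add_div, mul_div_assoc]

/-- The log-Riesz weights with `κ_M = (log M)^θ` (`θ > 0`) and class constant `r > 0` are regular (the package of
`logRiesz_regular`). [folklore] -/
theorem logRiesz_logPow_regular {θ : ℝ} (hθ : 0 < θ) {r : ℝ} (hr : 0 < r) :
    (∀ᶠ M : ℕ in atTop, Antitone (fun n : ℕ => max (1 - Real.log (Real.log M ^ θ * r * n) / Real.log M) 0)) ∧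
    (∀ᶠ M : ℕ in atTop, ∀ n : ℕ, 0 ≤ max (1 - Real.log (Real.log M ^ θ * r * n) / Real.log M) 0) ∧
    (∀ᶠ M : ℕ in atTop, ∀ n : ℕ, max (1 - Real.log (Real.log M ^ θ * r * n) / Real.log M) 0 ≤ 1) ∧
    (∀ᶠ M : ℕ in atTop, ∀ n : ℕ, M ≤ n → max (1 - Real.log (Real.log M ^ θ * r * n) / Real.log M) 0 = 0) ∧
    (∀ n : ℕ, Tendsto (fun M : ℕ => max (1 - Real.log (Real.log (M : ℝ) ^ θ * r * n) / Real.log M) 0) atTop (𝓝 1)) :=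
  logRiesz_regular (κ := fun M : ℕ => Real.log M ^ θ) (logPow_mul_eventually_one_le hθ hr)
    (tendsto_log_logPow_mul_div_log θ hr)

end TypeDesign

end Literature.NumberTheory.LFunctions
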